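import Summits.ResolutionOfSingularities.ResolutionOfSingularities.Theorems.PurelyInseparableDim4CoordinateSNC
import Summits.ResolutionOfSingularities.ResolutionOfSingularities.Theorems.PurelyInseparableDim4ChartCover
import Literature.AlgebraicGeometry.Resolution.JacobianCriterion
import Literature.AlgebraicGeometry.Resolution.StrictNormalCrossingsDescent
import Literature.AlgebraicGeometry.Resolution.StrictNormalCrossingsLabels
import Mathlib.Data.Fin.Tuple.Sort
import Mathlib.LinearAlgebra.Matrix.Block
import Mathlib.Algebra.MvPolynomial.PDeriv
import HarnessLib

/-!
# Purely inseparable four-folds `z^p + F(x₁, …, x₄)`: a JACOBIAN ENGINE for simple normal crossings on affine space —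
# `HasSNCWith E (V(x_Λ))` from a pointwise TRIANGULAR system of partial derivatives (S3-N2 support; cell `res-dim4-pi`, typ-2 g6)

[OURS · counted 0] (D-0157 DOOR 2; DR-157-C; desk WORD #115 (a)/(c), #131 (c); typ-2 g5 HANDOFF «positives with far members
for `j ∉ S'` — needs chart-level snc with QUADRIC members (pointwise regular systems)»). The positive side of the S3-N2
dichotomy was typed so far only for boundaries whose chart readings stay in the hyperplane alphabet `{xᵢ·𝒪, (xᵢ + c)·𝒪,
(x_m + b·x_j)·𝒪}` (p691155, p692862, p697351: ONE global automorphism straightens everything). FAR old members read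
QUADRICS `((yᵢ + bᵢ)·y_j + cᵢ)·𝒪` (p699206), which no automorphism of `𝔸⁵` straightens (the hypersurface `{y·y' = c}`,
`c ≠ 0`, has non-constant units). This file PROVES a pointwise criterion that needs no straightening (no `sorry`, no new
axiom, every `n`, every field `K`):

* `det_not_mem_of_rank` — a square matrix over a ring whose diagonal entries lie outside a prime `𝔭` and whose entry
  `(i, j)` lies in `𝔭` whenever `j ≠ i` has rank `ρ j ≤ ρ i` (triangular modulo `𝔭` after sorting by `ρ`, `Tuple.sort`)
  has determinant outside `𝔭`;
* `isRsopPart_algebraMap_of_det_not_mem` — **polynomials `f₁, …, f_r ∈ 𝔭` with `det (∂f_b/∂y_{v(a)}) ∉ 𝔭` are part of a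
  regular system of parameters of `𝒪_{𝔸ⁿ⁺¹, 𝔭}`** (Matsumura 30.4: the tree's `coeff_mem_maximalIdeal_of_sum_mul_mem_sq`
  gives independence modulo `𝔪²`, `exists_extend_to_rsop` extends to a minimal basis of `𝔪`; `𝔸ⁿ⁺¹` is smooth);
* **`hasSNCWith_𝓘Λ_of_jacobian`** — let `E` be a list of ideal sheaves on `𝔸ⁿ⁺¹_K` each `⊤` or `q·𝒪` for `q` in a finite
  set `Φ` of polynomials, and `Λ` a set of coordinates. Suppose that at every point `𝔭`, for the FAMILY AT `𝔭` — the `q ∈ Φ`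
  with `q ∈ 𝔭`, together with the variables `yᵢ`, `i ∈ Λ`, when `y_Λ ⊆ 𝔭` — there are an OWNER variable `v q` and a RANK
  `ρ q` per equation with `∂q/∂y_{v q} ∉ 𝔭` and `∂q/∂y_{v q'} ∈ 𝔭` for every other equation `q'` of the family of rank
  `≥ ρ q`. Then `HasSNCWith E (𝓘Λ n K Λ)` (labels for `hasSNCWith_of_isRsopPart_labels`).

For the escaping global centre of S3-N1 this turns «`Zc` snc with the transformed boundary» into a finite list of
two-member checks on each chart (typ-2 g6's far-positive files). Nothing here is a statement about resolution of
singularities in dimension ≥ 4 / characteristic `p` (NOT proved anywhere in this programme). bears_on: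
LADDER-RESOLUTION:D157-DOOR2 (res-dim4-pi). Supports stmt-ResolutionOfSingularities-16155 (helper, S3-N2 positive side).
-/

-- every declaration of this summit lives under `Summit.ResolutionOfSingularities.ResolutionOfSingularities`
-- (summit = problem), which the duplicate-namespace linter flags; house convention (cf. the Target file).
set_option linter.dupNamespace false

noncomputable section

open MvPolynomial CategoryTheory AlgebraicGeometry Opposite TopologicalSpace IsLocalRing
open AlgebraicGeometry.Scheme.IdealSheafData (ofIdealTop)

namespace Summit.ResolutionOfSingularities.ResolutionOfSingularities.Theorems.PIDim4

open Literature.AlgebraicGeometry.Resolution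
open Literature.AlgebraicGeometry.Resolution.AffinePointBlowup (P A γ coord Wtop ξ)
open Literature.AlgebraicGeometry.Hironaka2017.SpecOrders
open Literature.AlgebraicGeometry.Hironaka2017.Lib

namespace ChartDictionary

/-! ## §1 Determinants triangular modulo a prime -/

/-- **A matrix triangular modulo a prime after sorting has invertible determinant modulo the prime**: if every diagonal
entry of `M` lies outside the prime `𝔭` and `M i j ∈ 𝔭` whenever `j ≠ i` and `ρ j ≤ ρ i`, then `det M ∉ 𝔭` (sort the
indices by `ρ`, `Tuple.sort`; modulo `𝔭` the sorted matrix is upper triangular with non-zero diagonal in the domain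
`R ⧸ 𝔭`). -/
theorem det_not_mem_of_rank {R : Type*} [CommRing R] (𝔭 : Ideal R) [𝔭.IsPrime] {r : ℕ} (M : Matrix (Fin r) (Fin r) R)
    (ρ : Fin r → ℕ) (hdiag : ∀ i, M i i ∉ 𝔭) (htri : ∀ i j, i ≠ j → ρ j ≤ ρ i → M i j ∈ 𝔭) : M.det ∉ 𝔭 := by
  classical
  intro hdet
  set σ : Equiv.Perm (Fin r) := Tuple.sort ρ with hσ
  have hmono : Monotone (ρ ∘ σ) := Tuple.monotone_sort ρ
  let N : Matrix (Fin r) (Fin r) (R ⧸ 𝔭) := (Ideal.Quotient.mk 𝔭).mapMatrix (M.submatrix σ σ)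
  have hN : N.det = 0 := by
    change ((Ideal.Quotient.mk 𝔭).mapMatrix (M.submatrix σ σ)).det = 0
    rw [← RingHom.map_det, Matrix.det_submatrix_equiv_self, Ideal.Quotient.eq_zero_iff_mem]
    exact hdet
  have hNtri : N.BlockTriangular id := by
    intro i j hij
    change Ideal.Quotient.mk 𝔭 (M (σ i) (σ j)) = 0
    rw [Ideal.Quotient.eq_zero_iff_mem]
    exact htri _ _ (fun e => (ne_of_lt hij) (σ.injective e).symm) (hmono (le_of_lt hij))
  rw [Matrix.det_of_upperTriangular hNtri, Finset.prod_eq_zero_iff] at hN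
  obtain ⟨i, -, hi⟩ := hN
  exact hdiag (σ i) (Ideal.Quotient.eq_zero_iff_mem.mp hi)

/-! ## §2 Parts of regular systems of parameters of `𝒪_{𝔸ⁿ⁺¹, 𝔭}` from a Jacobian minor -/

variable {n : ℕ} {K : Type} [Field K]

/-- The local rings of affine space are regular (smooth over the field). -/
theorem isRegularLocalRing_stalk_affineSpace (x : P n K) : IsRegularLocalRing ((P n K).presheaf.stalk x) := by
  haveI := AffinePointBlowup.smooth_f n K
  exact Scheme.IsRegular.of_smooth (AffinePointBlowup.f n K) (Scheme.isRegular_Spec (CommRingCat.of K)) x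

/-- **Polynomials `f₁, …, f_r ∈ 𝔭` whose Jacobian minor `det (∂f_b/∂y_{v a})_{a,b}` lies outside `𝔭` are part of a regular
system of parameters of `𝒪_{𝔸ⁿ⁺¹_K, 𝔭}`** (Matsumura Thm. 30.4: independence modulo `𝔪²` by the tree's
`coeff_mem_maximalIdeal_of_sum_mul_mem_sq` with the derivations `∂/∂y_{v a}`, then `exists_extend_to_rsop`). -/
theorem isRsopPart_algebraMap_of_det_not_mem (x : P n K) {r : ℕ} (f : Fin r → A n K) (hf : ∀ a, f a ∈ x.asIdeal)
    (v : Fin r → Fin (n + 1)) (hdet : (Matrix.of fun a b => pderiv (v a) (f b)).det ∉ x.asIdeal) :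
    IsRsopPart fun a => algebraMap (A n K) ((P n K).presheaf.stalk x) (f a) := by
  haveI := isRegularLocalRing_stalk_affineSpace x
  have hm : ∀ a, algebraMap (A n K) ((P n K).presheaf.stalk x) (f a) ∈ maximalIdeal ((P n K).presheaf.stalk x) := by
    intro a
    rw [maximalIdeal_St]
    exact Ideal.mem_map_of_mem _ (hf a)
  let D : Fin r → Derivation ℤ (A n K) (A n K) := fun a =>
    (pderiv (v a) : Derivation K (A n K) (A n K)).restrictScalars ℤ
  have hdet' : (Matrix.of fun a b => D a (f b)).det ∉ x.asIdeal := hdet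
  have hind := coeff_mem_maximalIdeal_of_sum_mul_mem_sq x.asIdeal ((P n K).presheaf.stalk x) D f hf hdet'
  obtain ⟨e, y, hdim, hspan⟩ :=
    exists_extend_to_rsop (fun a => algebraMap (A n K) ((P n K).presheaf.stalk x) (f a)) hm
      (fun c hc a => hind c hc a)
  exact ⟨inferInstance, e, y, hdim, hspan⟩

/-! ## §3 The criterion -/

/-- Support of a principal sheaf `q·𝒪` on `𝔸ⁿ⁺¹`: `𝔭 ∈ supp ↔ q ∈ 𝔭`. -/
theorem mem_support_ofIdealTop_span_γ_symm_iff (q : A n K) (x : P n K) :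
    x ∈ (ofIdealTop (Ideal.span {(γ n K).symm q})).support ↔ q ∈ x.asIdeal := by
  rw [ofIdealTop_span_γ_symm_eq_shf, mem_support_shf_iff, Ideal.span_singleton_le_iff_mem]

/-- Stalk of a principal sheaf `q·𝒪` on `𝔸ⁿ⁺¹`: `(q·𝒪)_𝔭 = (q/1)·𝒪_𝔭`. -/
theorem stalkIdeal_ofIdealTop_span_γ_symm (q : A n K) (x : P n K) :
    stalkIdeal (ofIdealTop (Ideal.span {(γ n K).symm q})) x =
      Ideal.span {algebraMap (A n K) ((P n K).presheaf.stalk x) q} := by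
  rw [ofIdealTop_span_γ_symm_eq_shf, stalkIdeal_shf, Ideal.map_span, Set.image_singleton]

/-- **SIMPLE NORMAL CROSSINGS WITH A COORDINATE CENTRE FROM A POINTWISE TRIANGULAR JACOBIAN.** On `𝔸ⁿ⁺¹_K` let `E` be a list
of ideal sheaves each equal to `⊤` or to `q·𝒪` for some `q` in the finite set `Φ`, and `Λ` a set of coordinates. At a point
`𝔭` call FAMILY the polynomials `q ∈ Φ` with `q ∈ 𝔭` together with, if `yᵢ ∈ 𝔭` for all `i ∈ Λ`, the variables `yᵢ`,
`i ∈ Λ`. If owners `v 𝔭 q` and ranks `ρ 𝔭 q` can be assigned so that `∂q/∂y_{v q} ∉ 𝔭` for every `q` of the family and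
`∂q/∂y_{v q'} ∈ 𝔭` for all distinct `q, q'` of the family with `ρ q ≤ ρ q'`, then `HasSNCWith E (𝓘Λ n K Λ)`: at `𝔭` the
family is part of a regular system of parameters (`isRsopPart_algebraMap_of_det_not_mem`, `det_not_mem_of_rank`) labelling
the members of `E` through `𝔭` and generating the stalk of the centre. -/
theorem hasSNCWith_𝓘Λ_of_jacobian (E : List (P n K).IdealSheafData) (Λ : Set (Fin (n + 1))) (Φ : Finset (A n K))
    (hE : ∀ D ∈ E, D = ⊤ ∨ ∃ q ∈ Φ, D = ofIdealTop (Ideal.span {(γ n K).symm q}))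
    (ρ : P n K → A n K → ℕ) (v : P n K → A n K → Fin (n + 1))
    (hdiag : ∀ (x : P n K) (q : A n K),
      (q ∈ Φ ∧ q ∈ x.asIdeal ∨ (∃ i ∈ Λ, q = X i) ∧ ∀ k ∈ Λ, (X k : A n K) ∈ x.asIdeal) →
        pderiv (v x q) q ∉ x.asIdeal)
    (htri : ∀ (x : P n K) (q q' : A n K),
      (q ∈ Φ ∧ q ∈ x.asIdeal ∨ (∃ i ∈ Λ, q = X i) ∧ ∀ k ∈ Λ, (X k : A n K) ∈ x.asIdeal) →
      (q' ∈ Φ ∧ q' ∈ x.asIdeal ∨ (∃ i ∈ Λ, q' = X i) ∧ ∀ k ∈ Λ, (X k : A n K) ∈ x.asIdeal) →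
        q ≠ q' → ρ x q ≤ ρ x q' → pderiv (v x q') q ∈ x.asIdeal) :
    HasSNCWith E (AffineCoordBlowup.𝓘Λ n K Λ) := by
  classical
  refine hasSNCWith_of_isRsopPart_labels E _ fun x => ?_
  -- the family at `x`, as a finite set of polynomials
  let fam : Finset (A n K) :=
    Φ.filter (fun q => q ∈ x.asIdeal) ∪
      (if ∀ k ∈ Λ, (X k : A n K) ∈ x.asIdeal then (Set.toFinite Λ).toFinset.image (fun i => (X i : A n K)) else ∅)
  have hfam : ∀ q, q ∈ fam ↔
      (q ∈ Φ ∧ q ∈ x.asIdeal ∨ (∃ i ∈ Λ, q = X i) ∧ ∀ k ∈ Λ, (X k : A n K) ∈ x.asIdeal) := by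
    intro q
    rw [Finset.mem_union, Finset.mem_filter]
    refine or_congr Iff.rfl ?_
    by_cases hΛ : ∀ k ∈ Λ, (X k : A n K) ∈ x.asIdeal
    · rw [if_pos hΛ, Finset.mem_image]
      constructor
      · rintro ⟨i, hi, rfl⟩
        exact ⟨⟨i, (Set.Finite.mem_toFinset _).mp hi, rfl⟩, hΛ⟩
      · rintro ⟨⟨i, hi, rfl⟩, -⟩
        exact ⟨i, (Set.Finite.mem_toFinset _).mpr hi, rfl⟩
    · rw [if_neg hΛ]
      constructor
      · intro h
        exact absurd h (Finset.notMem_empty q)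
      · rintro ⟨-, h⟩
        exact absurd h hΛ
  have hfam𝔭 : ∀ q ∈ fam, q ∈ x.asIdeal := by
    intro q hq
    rcases (hfam q).mp hq with ⟨-, h⟩ | ⟨⟨i, hi, rfl⟩, h⟩
    · exact h
    · exact h i hi
  -- enumerate it
  set r := fam.card with hr
  let e : fam ≃ Fin r := fam.equivFin
  let f : Fin r → A n K := fun a => ((e.symm a : fam) : A n K)
  have hfmem : ∀ a, f a ∈ fam := fun a => (e.symm a).2
  have hfinj : Function.Injective f := Subtype.val_injective.comp e.symm.injective
  have hfe : ∀ q : fam, f (e q) = q := fun q => by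
    simp only [f, Equiv.symm_apply_apply]
  -- the Jacobian minor and the part of a regular system of parameters
  have hdet : (Matrix.of fun a b => pderiv (v x (f a)) (f b)).det ∉ x.asIdeal :=
    det_not_mem_of_rank x.asIdeal _ (fun a => ρ x (f a)) (fun a => hdiag x (f a) ((hfam _).mp (hfmem a)))
      (fun a b hab hρ => htri x (f b) (f a) ((hfam _).mp (hfmem b)) ((hfam _).mp (hfmem a))
        (fun e' => hab (hfinj e').symm) hρ)
  have hz : IsRsopPart fun a => algebraMap (A n K) ((P n K).presheaf.stalk x) (f a) :=
    isRsopPart_algebraMap_of_det_not_mem x f (fun a => hfam𝔭 _ (hfmem a)) (fun a => v x (f a)) hdet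
  -- the equation of a member of `E` through `x`
  have hEq : ∀ D : {D : (P n K).IdealSheafData // D ∈ E ∧ x ∈ D.support},
      ∃ q : fam, D.1 = ofIdealTop (Ideal.span {(γ n K).symm (q : A n K)}) := by
    intro D
    rcases hE D.1 D.2.1 with hD | ⟨q, hqΦ, hD⟩
    · exfalso
      have h := D.2.2
      rw [hD, Scheme.IdealSheafData.support_top] at h
      exact h
    · have hq𝔭 : q ∈ x.asIdeal := by
        have h := D.2.2
        rw [hD, mem_support_ofIdealTop_span_γ_symm_iff] at h
        exact h
      exact ⟨⟨q, (hfam q).mpr (Or.inl ⟨hqΦ, hq𝔭⟩)⟩, hD⟩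
  choose qf hqf using hEq
  refine ⟨r, _, hz, ⟨fun D => e (qf D), ?_, fun D => ?_⟩, fun hxC => ?_⟩
  · -- injectivity of the labels
    intro D₁ D₂ h12
    have h : qf D₁ = qf D₂ := e.injective h12
    apply Subtype.ext
    rw [hqf D₁, hqf D₂, h]
  · -- the stalk of a member is generated by its equation
    change stalkIdeal D.1 x = Ideal.span {algebraMap (A n K) ((P n K).presheaf.stalk x) (f (e (qf D)))}
    rw [hfe, hqf D, stalkIdeal_ofIdealTop_span_γ_symm]
  · -- the stalk of the centre is generated by the variables `yᵢ`, `i ∈ Λ`, all in the family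
    have hΛ : ∀ k ∈ Λ, (X k : A n K) ∈ x.asIdeal := (mem_support_𝓘Λ_iff Λ x).mp hxC
    have hXmem : ∀ i ∈ Λ, (X i : A n K) ∈ fam := fun i hi => (hfam _).mpr (Or.inr ⟨⟨i, hi, rfl⟩, hΛ⟩)
    refine ⟨{a | ∃ i ∈ Λ, f a = X i}, ?_⟩
    rw [stalkIdeal_𝓘Λ_eq_span_image]
    congr 1
    ext g
    constructor
    · rintro ⟨i, hi, rfl⟩
      refine ⟨e ⟨X i, hXmem i hi⟩, ⟨i, hi, hfe _⟩, ?_⟩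
      change algebraMap (A n K) ((P n K).presheaf.stalk x) (f (e ⟨X i, hXmem i hi⟩)) = _
      rw [hfe]
    · rintro ⟨a, ⟨i, hi, ha⟩, rfl⟩
      refine ⟨i, hi, ?_⟩
      change _ = algebraMap (A n K) ((P n K).presheaf.stalk x) (f a)
      rw [ha]

end ChartDictionary

end Summit.ResolutionOfSingularities.ResolutionOfSingularities.Theorems.PIDim4

end
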